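import Literature.NumberTheory.NumberFields.HasseUnitIndexOddDegree
import HarnessLib

/-!
# Hasse's unit index: the criteria Satz 25, Satz 29, Satz 26 (Lemmermeyer 1995, Prop. 1 c), d), e))

Topic `NumberTheory/NumberFields`; namespace `Literature.NumberTheory.NumberFields.Lemmermeyer1995` (the
namespace of `HasseUnitIndexOddDegree.lean`, which proves Prop. 1 a) and f)).  Theorem-only file (no
definition, no named fact, no `sorry`).  `Q(L) = (E_L : W_L E_{L⁺}) ∈ {1, 2}` is Hasse's unit index of the
CM field `L` (Mathlib `indexRealUnits`), `W_L` its roots of unity (`torsion L`), `σ` complex conjugation,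
`E_L^{σ-1} = {ε/ε̄}` (the range of Mathlib's `unitsMulComplexConjInv L : u ↦ u ū⁻¹`).

> F. Lemmermeyer, *Ideal class groups of cyclotomic number fields I*, Acta Arith. 72 (1995), §2,
> **Proposition 1.** "Let `K ⊂ L` be CM-fields; then a) (Satz 14) `Q(L) = (E_L : W_L E_{L⁺}) =
> (E_L^{σ-1} : W_L²) = (E_L^{σ+1} : E_{L⁺}²)`; in particular, `Q(L) ∈ {1, 2}`.  b) (Satz 16, 17) if
> `Q(L) = 2` then `κ_{L/L⁺} = 1`;  **c) (Satz 25) If `L⁺` contains units with any given signature, then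
> `Q(L) = 1`.  d) (Satz 29) `Q(K) | Q(L) · (W_L : W_K)`;  e) (compare Satz 26) Suppose that
> `N_{L/K} : W_L/W_L² → W_K/W_K²` is onto.  Then `Q(L) | Q(K)`**.  f) ([HY]) If `(L : K)` is odd, then
> `Q(L) = Q(K)` …  The proofs are straight forward: … c) Units in `L⁺` that are norms from `L` are totally
> positive; our assumption implies that totally positive units are squares, hence we get
> `E_L^{σ+1} = E_{L⁺}²`, and our claim follows from a).  d) First note that `(W_L : W_K) = (W_L² : W_K²)`;
> then `Q(L)·(W_L : W_K) = (E_L^{σ-1} : W_L²)(W_L² : W_K²) = (E_L^{σ-1} : E_K^{σ-1})(E_K^{σ-1} : W_K²) =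
> (E_L^{σ-1} : E_K^{σ-1}) · Q(K)` proves the claim.  e) Since `Q(L) = 2`, there is a unit `ε ∈ E_L` such
> that `ε^{σ-1} = ζ` generates `W_L/W_L²`.  Taking the norm to `K` shows that `(N_{L/K} ε)^{σ-1} = N_{L/K}(ζ)`
> generates `W_K/W_K²`, i.e. we have `Q(K) = 2`."  ("Satz `*`" refers to Hasse's *Über die
> Klassenzahl abelscher Zahlkörper*.)

(a), b), f) are in the tree: `Lemmermeyer1995.indexRealUnits_eq_one_iff`, Mathlib's
`indexRealUnits_eq_one_or_two`, `classGroupExtend_injective_of_indexRealUnits_eq_two`,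
`Lemmermeyer1995_unitIndex_eq_of_odd_degree_holds`.)

## Main results

* **`indexRealUnits_eq_one_of_forall_isSquare`** — c) (Satz 25) with Lemmermeyer's operative hypothesis:
  if every totally positive unit of `K⁺` is a square, then `Q(K) = 1`.  Steps as printed:
  `embedding_pos_of_algebraMap_eq_mul_unitsComplexConj` (norms `u ū` of units are totally positive),
  then `u ū = t²` with `t` real gives `u/ū = (u/t)²`, a square in `W_K`, and a) concludes.
* **`indexRealUnits_dvd_mul_relIndex_torsion`** — d) (Satz 29): `Q(K) ∣ Q(L) · (W_L : W_K)`.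
* **`indexRealUnits_eq_two_of_exists_norm_ne_sq`**, `indexRealUnits_dvd_of_exists_norm_ne_sq` — e):
  if some root of unity of `L` has norm to `K` outside `W_K²` (i.e. `N_{L/K} : W_L/W_L² → W_K/W_K²` is
  onto), then `Q(L) = 2 ⟹ Q(K) = 2`, i.e. `Q(L) ∣ Q(K)`.

Related formalizations (found after this file landed): the Arthur-2013 audit leaves type the same three items in
their dictionary vocabulary for a general quadratic datum `(c, h2, hc, hTR)` —
`Literature/NumberTheory/Automorphic/Arthur2013/Leaves/TorusSignatures.lean` (`…TECR.TorusDict.indexRealUnits_eq_one_of_forall_pos_isSquare`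
= c), with the signature-count reduction `forall_units_eq_sq_of_pos_of_signatures`, `indexRealUnits_eq_one_of_signatures`
giving c) in its printed «any given signature» form) and `…/Leaves/TorusCyclotomic.lean`
(`indexRealUnits_dvd_indexRealUnits_mul_relIndex_torsion` = d), `indexRealUnits_eq_two_of_tower_of_norm` ≈ e)).  The
present file is the light-import statement over Mathlib's `maximalRealSubfield` in the `Lemmermeyer1995` namespace;
`HasseUnitIndexOddNarrowClassNumber.lean` derives c)'s hypothesis from an odd narrow class number of `K⁺`.

Honest column: in c) the printed hypothesis «`L⁺` contains units with any given signature» is replaced by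
its consequence used in the printed proof, «totally positive units are squares» (the reduction, a unit-rank
count, is not formalised); d) is proved by the case analysis `Q ∈ {1, 2}` (the only non-trivial case,
`Q(K) = 2`, `Q(L) = 1`, forces `W_K ⊆ W_L²`, so `2 ∣ (W_L : W_K)`) rather than by the printed chain of
indices; «onto `W_K/W_K²`» in e) is rendered as: some `ζ ∈ W_L` has `N_{L/K} ζ ∉ W_K²`.

## References

* F. Lemmermeyer, *Ideal class groups of cyclotomic number fields I*, Acta Arith. 72 (1995) 347–359, §2
  Proposition 1 and its proof (held `paper:arxiv-1202.5777`, p. 4). [Lemmermeyer1995]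
* H. Hasse, *Über die Klassenzahl abelscher Zahlkörper* (1952), Sätze 25, 26, 29 (as cited there).
* L. C. Washington, *Introduction to Cyclotomic Fields*, 2nd ed. (1997), Thm. 4.12. [Washington1997]
-/

noncomputable section

open NumberField NumberField.IsCMField NumberField.Units

namespace Literature.NumberTheory.NumberFields

namespace Lemmermeyer1995

/-! ### c) (Hasse, Satz 25): totally positive units of `K⁺` squares `⟹ Q(K) = 1` -/

section SatzTwentyFive

variable (K : Type*) [Field K] [NumberField K] [IsCMField K]

/-- `σ² = 1` on units. [folklore] -/
private theorem unitsComplexConj_unitsComplexConj (u : (𝓞 K)ˣ) :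
    unitsComplexConj K (unitsComplexConj K u) = u := by
  refine Units.ext (RingOfIntegers.ext ?_)
  change complexConj K (complexConj K (((u : 𝓞 K)) : K)) = _
  exact complexConj_apply_apply K _

/-- `u ū` is a real unit: `u ū = η` for a unit `η` of `K⁺` (`E_L^{σ+1} ⊆ E_{L⁺}`).
[cite: Lemmermeyer1995, §2 Proposition 1 a), c) (proof)] -/
theorem exists_algebraMap_eq_mul_unitsComplexConj (u : (𝓞 K)ˣ) :
    ∃ η : (𝓞 (maximalRealSubfield K))ˣ,
      algebraMap (𝓞 (maximalRealSubfield K)) (𝓞 K) η = ((u * unitsComplexConj K u : (𝓞 K)ˣ) : 𝓞 K) := by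
  have hreal : unitsComplexConj K (u * unitsComplexConj K u) = u * unitsComplexConj K u := by
    rw [map_mul, unitsComplexConj_unitsComplexConj, mul_comm]
  exact (mem_realUnits_iff K _).mp ((unitsComplexConj_eq_self_iff K _).mp hreal)

/-- **«Units in `L⁺` that are norms from `L` are totally positive»**: if `η ∈ E_{K⁺}` satisfies `η = u ū` for
a unit `u` of the CM field `K`, then `φ(η) > 0` for every real embedding `φ` of `K⁺` (extend `φ` to
`τ : K → ℂ`; then `φ(η) = τ(u) \overline{τ(u)} = |τ(u)|² > 0`). [cite: Lemmermeyer1995, §2 Proposition 1 c) (proof)] -/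
theorem embedding_pos_of_algebraMap_eq_mul_unitsComplexConj {η : (𝓞 (maximalRealSubfield K))ˣ}
    {u : (𝓞 K)ˣ}
    (h : algebraMap (𝓞 (maximalRealSubfield K)) (𝓞 K) η = ((u * unitsComplexConj K u : (𝓞 K)ˣ) : 𝓞 K))
    (φ : maximalRealSubfield K →+* ℝ) : 0 < φ ((η : 𝓞 (maximalRealSubfield K)) : maximalRealSubfield K) := by
  set τ : K →+* ℂ := NumberField.ComplexEmbedding.lift K (Complex.ofRealHom.comp φ) with hτdef
  have hτ : τ (algebraMap (maximalRealSubfield K) K ((η : 𝓞 (maximalRealSubfield K)) : maximalRealSubfield K)) =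
      ((φ ((η : 𝓞 (maximalRealSubfield K)) : maximalRealSubfield K) : ℝ) : ℂ) := by
    rw [hτdef, NumberField.ComplexEmbedding.lift_algebraMap_apply]; rfl
  have h' : algebraMap (maximalRealSubfield K) K ((η : 𝓞 (maximalRealSubfield K)) : maximalRealSubfield K) =
      ((u : 𝓞 K) : K) * complexConj K ((u : 𝓞 K) : K) :=
    congrArg (fun x : 𝓞 K => (x : K)) h
  rw [h', map_mul, complexEmbedding_complexConj K τ, Complex.mul_conj] at hτ
  have hu0 : τ ((u : 𝓞 K) : K) ≠ 0 :=
    (map_ne_zero τ).mpr (RingOfIntegers.coe_ne_zero_iff.mpr (Units.ne_zero u))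
  have hpos : 0 < Complex.normSq (τ ((u : 𝓞 K) : K)) := Complex.normSq_pos.mpr hu0
  have hre := congrArg Complex.re hτ
  simp only [Complex.ofReal_re] at hre
  rw [← hre]
  exact hpos

/-- **Lemmermeyer's Prop. 1 c) (Hasse, Satz 25): if every totally positive unit of `K⁺` is a square, then
`Q(K) = 1`** («our assumption implies that totally positive units are squares, hence we get
`E_L^{σ+1} = E_{L⁺}²`, and our claim follows from a)»: `u ū = t²` with `t̄ = t`, so `u/ū = (u/t)²` is a
square in `W_K` for every unit `u`). [cite: Lemmermeyer1995, §2 Proposition 1 c)]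
[cite: Washington1997, Thm. 4.12] -/
theorem indexRealUnits_eq_one_of_forall_isSquare
    (hE : ∀ η : (𝓞 (maximalRealSubfield K))ˣ,
      (∀ φ : maximalRealSubfield K →+* ℝ, 0 < φ ((η : 𝓞 (maximalRealSubfield K)) : maximalRealSubfield K)) →
        IsSquare η) :
    indexRealUnits K = 1 := by
  rw [indexRealUnits_eq_one_iff]
  intro u
  obtain ⟨η, hη⟩ := exists_algebraMap_eq_mul_unitsComplexConj K u
  obtain ⟨θ, hθ⟩ := hE η (embedding_pos_of_algebraMap_eq_mul_unitsComplexConj K hη)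
  -- the real unit `t = θ` of `K` with `u ū = t²`
  set t : (𝓞 K)ˣ := Units.map (algebraMap (𝓞 (maximalRealSubfield K)) (𝓞 K) : 𝓞 (maximalRealSubfield K) →* 𝓞 K) θ
    with htdef
  have hut : u * unitsComplexConj K u = t * t := by
    apply Units.ext
    rw [← hη, hθ, Units.val_mul, map_mul, Units.val_mul, htdef, Units.coe_map, MonoidHom.coe_coe]
  -- `r = u/t` squares to `u/ū`
  set r : (𝓞 K)ˣ := u * t⁻¹ with hrdef
  have hr : (unitsMulComplexConjInv K u : (𝓞 K)ˣ) = r * r := by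
    rw [unitsMulComplexConjInv_apply, hrdef]
    have h1 : unitsComplexConj K u = u⁻¹ * (t * t) := by rw [eq_inv_mul_iff_mul_eq, hut]
    rw [h1, mul_inv_rev, mul_inv_rev, inv_inv]
    simp only [mul_comm, mul_left_comm]
  have hrtor : r ∈ torsion K := by
    rw [torsion, CommGroup.mem_torsion]
    refine IsOfFinOrder.of_pow (n := 2) ?_ two_ne_zero
    rw [pow_two, ← hr]
    exact (unitsMulComplexConjInv K u).2
  exact ⟨⟨r, hrtor⟩, Subtype.ext (by rw [hr]; rfl)⟩

end SatzTwentyFive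

/-! ### d) (Hasse, Satz 29): `Q(K) ∣ Q(L) · (W_L : W_K)`, and e) (Satz 26): `Q(L) ∣ Q(K)` -/

section SatzTwentyNine

variable (K L : Type*) [Field K] [NumberField K] [IsCMField K]
    [Field L] [NumberField L] [IsCMField L] [Algebra K L]

/-- `Q(K) = 2 ⟹ E_K^{σ-1} = W_K` (every root of unity is of the form `u/ū`).
[cite: Lemmermeyer1995, §2 Proposition 1 a)] -/
theorem range_unitsMulComplexConjInv_eq_top (hQ : indexRealUnits K = 2) :
    (unitsMulComplexConjInv K).range = ⊤ := by
  have h := indexRealUnits_mul_eq K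
  rw [hQ] at h
  exact Subgroup.index_eq_one.mp (by omega)

/-- **Lemmermeyer's Prop. 1 d) (Hasse, Satz 29): `Q(K) ∣ Q(L) · (W_L : W_K)`** for CM fields `K ⊂ L`,
with `(W_L : W_K)` the index in `W_L = torsion L` of the image of `W_K`.  (If `Q(K) = 2` and `Q(L) = 1`
then `W_K = E_K^{σ-1} ⊆ E_L^{σ-1} = W_L²`, so `2 = (W_L : W_L²) ∣ (W_L : W_K)`.)
[cite: Lemmermeyer1995, §2 Proposition 1 d)] -/
theorem indexRealUnits_dvd_mul_relIndex_torsion :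
    indexRealUnits K ∣ indexRealUnits L *
      ((torsion K).map (Units.map (algebraMap (𝓞 K) (𝓞 L) : 𝓞 K →* 𝓞 L))).relIndex (torsion L) := by
  rcases indexRealUnits_eq_one_or_two K with hK | hK
  · rw [hK]; exact one_dvd _
  rcases indexRealUnits_eq_one_or_two L with hL | hL
  · -- the non-trivial case `Q(K) = 2`, `Q(L) = 1`
    rw [hK, hL, one_mul]
    -- the squares of `W_L`, as a subgroup of `E_L`
    set S : Subgroup (𝓞 L)ˣ := ((powMonoidHom 2 : torsion L →* torsion L).range).map (torsion L).subtype
      with hS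
    have hS2 : S.relIndex (torsion L) = 2 := by
      change (S.subgroupOf (torsion L)).index = 2
      rw [hS, Subgroup.subgroupOf, Subgroup.comap_map_eq_self_of_injective (torsion L).subtype_injective,
        IsCyclic.index_powMonoidHom_range, Nat.gcd_eq_right]
      exact even_iff_two_dvd.mp (even_torsionOrder L)
    rw [← hS2]
    apply Subgroup.relIndex_dvd_of_le_left
    -- `W_K ⊆ W_L²`
    rintro _ ⟨ζ, hζ, rfl⟩
    have htop := range_unitsMulComplexConjInv_eq_top K hK
    obtain ⟨u, hu⟩ : (⟨ζ, hζ⟩ : torsion K) ∈ (unitsMulComplexConjInv K).range := by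
      rw [htop]; exact Subgroup.mem_top _
    obtain ⟨r, hr⟩ := (indexRealUnits_eq_one_iff L).mp hL
      (Units.map (algebraMap (𝓞 K) (𝓞 L) : 𝓞 K →* 𝓞 L) u)
    refine ⟨r * r, ⟨r, by rw [powMonoidHom_apply, pow_two]⟩, ?_⟩
    rw [Subgroup.coe_subtype]
    have hu' : (ζ : (𝓞 K)ˣ) = (unitsMulComplexConjInv K u : (𝓞 K)ˣ) := by rw [hu]
    rw [hu', unitsMap_unitsMulComplexConjInv K L u, hr]
  · rw [hK, hL]; exact Dvd.intro _ rfl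

/-- **Lemmermeyer's Prop. 1 e) (compare Hasse, Satz 26): if some root of unity `ζ ∈ W_L` has
`N_{L/K}(ζ) ∉ W_K²` (i.e. `N_{L/K} : W_L/W_L² → W_K/W_K²` is onto), then `Q(L) = 2 ⟹ Q(K) = 2`**
(«there is a unit `ε ∈ E_L` such that `ε^{σ-1} = ζ` … `(N_{L/K} ε)^{σ-1} = N_{L/K}(ζ)` generates `W_K/W_K²`,
i.e. we have `Q(K) = 2`»). [cite: Lemmermeyer1995, §2 Proposition 1 e)] -/
theorem indexRealUnits_eq_two_of_exists_norm_ne_sq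
    (hζ : ∃ ζ ∈ torsion L, ∀ r ∈ torsion K, Units.map (RingOfIntegers.norm K : 𝓞 L →* 𝓞 K) ζ ≠ r ^ 2)
    (hL : indexRealUnits L = 2) : indexRealUnits K = 2 := by
  obtain ⟨ζ, hζt, hζ⟩ := hζ
  have htop := range_unitsMulComplexConjInv_eq_top L hL
  obtain ⟨v, hv⟩ : (⟨ζ, hζt⟩ : torsion L) ∈ (unitsMulComplexConjInv L).range := by
    rw [htop]; exact Subgroup.mem_top _
  rcases indexRealUnits_eq_one_or_two K with hK | hK
  · exfalso
    obtain ⟨r, hr⟩ := (indexRealUnits_eq_one_iff K).mp hK (Units.map (RingOfIntegers.norm K : 𝓞 L →* 𝓞 K) v)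
    apply hζ r r.2
    have hv' : ζ = (unitsMulComplexConjInv L v : (𝓞 L)ˣ) := by rw [hv]
    rw [hv', unitsNorm_unitsMulComplexConjInv K L v, hr, pow_two]
    rfl
  · exact hK

/-- **Prop. 1 e) as a divisibility: `Q(L) ∣ Q(K)`** under the same hypothesis.
[cite: Lemmermeyer1995, §2 Proposition 1 e)] -/
theorem indexRealUnits_dvd_of_exists_norm_ne_sq
    (hζ : ∃ ζ ∈ torsion L, ∀ r ∈ torsion K, Units.map (RingOfIntegers.norm K : 𝓞 L →* 𝓞 K) ζ ≠ r ^ 2) :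
    indexRealUnits L ∣ indexRealUnits K := by
  rcases indexRealUnits_eq_one_or_two L with hL | hL
  · rw [hL]; exact one_dvd _
  · rw [hL, indexRealUnits_eq_two_of_exists_norm_ne_sq K L hζ hL]

end SatzTwentyNine

end Lemmermeyer1995

end Literature.NumberTheory.NumberFields

end
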